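import Summits.KontsevichZagierPeriods.Zeta5Search.Barrier.ConeGammaLogCuspThin

/-!
# ζ(5) search — BARRIER: the saving is 1-Lipschitz in the CROSSING COUNT; exact equidistribution over a period

HONEST FRAMING (cell `pub-zeta5`): systematic search; no irrationality claim unless kernel-certified. MODEL objects
under Brown–Zudilin's (28)+(30) accounting ([BZ22] = arXiv:2210.03391; (28) observed, not proved); nothing here is a
statement about `ζ(5)`, about `γ`, or about the cone's supremum (C2 = `BarrierC2` stays OPEN; the lemma S-E with
useful constants stays CONJECTURED); records in print UNMOVED. Prover P2 g20 (self-selected Lean-only item of the P2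
lineage: the two «elementary but unreviewed» facts (a), (b) of lead/lit g27's `SE-DESK-NOTE.md` §2 made kernel, and
the first-moment bound of P2 g19's `ConeGammaLogCuspThin` brought from the crude thin-set constant
`392·Y·(T·x_max + 5)/x_min` to the desk note's scale `T·Σ_k |φ_k(δ)|`).

* `sum_univ_phiForm_permS₂` — TWO-point symmetric statistics `Σ_k g(φ_k θ, φ_k θ′)` of the 28 forms are
  `S₇`-invariant (same double-counting proof as `sum_univ_phiForm_permS`).
* **`abs_torusTerm_sub_le`**, **`abs_torusN_sub_le_sum_abs_floor_sub`** — desk-note fact (a):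
  `|𝒩(θ′) − 𝒩(θ)| ≤ Σ_k |⌊φ_k θ′⌋ − ⌊φ_k θ⌋|` for ALL `θ, θ′ ∈ ℝ⁸` (one wall crossing moves `𝒩` by at most `1`):
  the `F`-sum of the floor increments is at most the sum of ALL positive parts, the permuted `F`-sum at least minus
  the sum of ALL negative parts, and those two full sums are `S₇`-invariant.
* `abs_floor_add_mul_sub_floor_le` — monotonicity: for `0 ≤ l ≤ t`, `|⌊y + l·φ⌋ − ⌊y⌋| ≤ |⌊y + t·φ⌋ − ⌊y⌋|`.
* **`integral_floor_shift_period`** — desk-note fact (b), EXACT equidistribution: for `x > 0` with `T·x ∈ ℤ`,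
  `∫₀ᵀ (⌊s·x + c + η⌋ − ⌊s·x + c⌋) ds = T·η` for every `c, η` (substitution `y = s·x + c`, `⌊y + N⌋ = ⌊y⌋ + N`);
  `integral_abs_floor_shift_period` — `∫_{(0,T]} |⌊s·x + c + η⌋ − ⌊s·x + c⌋| ds = T·|η|`.
* **`setIntegral_abs_torusN_sub_le_period`** — hence, along the line `s ↦ s·s(a) + c` of a direction with all
  forms positive and a PERIOD `T` (`T·h_k(a) ∈ ℤ`), a displacement `λ(s)·δ` with `0 ≤ λ ≤ t` on `(0, T]` changes `𝒩`
  at `L¹((0,T])`-cost `≤ t·T·Σ_k |φ_k(δ)|` — the desk note's `‖A_k‖, ‖B_k‖ ≤ λ₀·(size)·σ(v)`; P2 g19's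
  `setIntegral_abs_torusN_sub_le_linear` has `t·392·Y·(T·x_max + 5)/x_min` here (no `1/x_min`, no `x_max`).
Not here: the head period with the `u⁻²` weight (`ConeGammaHeadHarmonic`), anything about `Φ`
(`ConeGammaTranslateDominanceSharp`).
-/

noncomputable section

open Set MeasureTheory
open scoped Topology

namespace Summit.KontsevichZagierPeriods.Zeta5Search.Barrier.ConeGamma

/-! ### Two-point symmetric statistics of the 28 forms are `S₇`-invariant -/

/-- **Every two-point symmetric statistic of the 28 forms is `S₇`-invariant**:
`Σ_k g(φ_k(σθ), φ_k(σθ′)) = Σ_k g(φ_k θ, φ_k θ′)`. -/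
theorem sum_univ_phiForm_permS₂ (g : ℝ → ℝ → ℝ) (σ : Equiv.Perm (Fin 7)) (θ θ' : Fin 8 → ℝ) :
    ∑ k : Fin 28, g (phiForm (permS σ θ) k) (phiForm (permS σ θ') k)
      = ∑ k : Fin 28, g (phiForm θ k) (phiForm θ' k) := by
  simp_rw [phiForm_permS, phiForm_eq]
  rw [sum_univ_fin28_eq_sum_allPairs
      (fun i j => g (pairForm θ (liftPerm σ i) (liftPerm σ j)) (pairForm θ' (liftPerm σ i) (liftPerm σ j))),
    sum_univ_fin28_eq_sum_allPairs (fun i j => g (pairForm θ i j) (pairForm θ' i j))]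
  have h := sum_allPairs_comp_perm (M := ℝ) (liftPerm σ) (fun i j => g (pairForm θ i j) (pairForm θ' i j))
    (fun i j => by rw [pairForm_comm θ, pairForm_comm θ'])
  simpa [two_nsmul, ← two_mul] using h

/-! ### Fact (a): `𝒩` is 1-Lipschitz in the crossing count -/

/-- `max d 0 + max (−d) 0 = |d|`. -/
theorem max_zero_add_max_neg_zero (d : ℝ) : max d 0 + max (-d) 0 = |d| := by
  rcases le_total 0 d with h | h
  · rw [max_eq_left h, max_eq_right (by linarith), abs_of_nonneg h, add_zero]
  · rw [max_eq_right h, max_eq_left (by linarith), abs_of_nonpos h, zero_add]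

/-- **One term.** For every `σ ∈ S₇` and all `θ, θ′`:
`|torusTerm θ′ σ − torusTerm θ σ| ≤ Σ_k |⌊φ_k θ′⌋ − ⌊φ_k θ⌋|`. -/
theorem abs_torusTerm_sub_le (θ θ' : Fin 8 → ℝ) (σ : Equiv.Perm (Fin 7)) :
    |(torusTerm θ' σ : ℝ) - torusTerm θ σ| ≤ ∑ k : Fin 28, |(⌊phiForm θ' k⌋ : ℝ) - ⌊phiForm θ k⌋| := by
  -- floor increments of the forms, at `θ` and at `σ·θ`
  set D : Fin 28 → ℝ := fun k => (⌊phiForm θ' k⌋ : ℝ) - ⌊phiForm θ k⌋ with hD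
  set E : Fin 28 → ℝ := fun k => (⌊phiForm (permS σ θ') k⌋ : ℝ) - ⌊phiForm (permS σ θ) k⌋ with hE
  have hdiff : (torusTerm θ' σ : ℝ) - torusTerm θ σ = ∑ i ∈ FIdx, D i - ∑ i ∈ FIdx, E i := by
    simp only [torusTerm, hD, hE, Int.cast_sum, Int.cast_sub, Finset.sum_sub_distrib]
    ring
  -- the full sums of positive / negative parts are `S₇`-invariant
  have hP : ∑ k, max (E k) 0 = ∑ k, max (D k) 0 :=
    sum_univ_phiForm_permS₂ (fun p q => max ((⌊q⌋ : ℝ) - ⌊p⌋) 0) σ θ θ'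
  have hN : ∑ k, max (-E k) 0 = ∑ k, max (-D k) 0 :=
    sum_univ_phiForm_permS₂ (fun p q => max (-((⌊q⌋ : ℝ) - ⌊p⌋)) 0) σ θ θ'
  have habs : ∑ k, max (D k) 0 + ∑ k, max (-D k) 0 = ∑ k, |D k| := by
    rw [← Finset.sum_add_distrib]
    exact Finset.sum_congr rfl fun k _ => max_zero_add_max_neg_zero (D k)
  -- partial sums against full sums of positive / negative parts
  have hsub : FIdx ⊆ (Finset.univ : Finset (Fin 28)) := Finset.subset_univ _
  have h1 : ∑ i ∈ FIdx, D i ≤ ∑ k, max (D k) 0 :=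
    (Finset.sum_le_sum fun i _ => le_max_left (D i) 0).trans
      (Finset.sum_le_sum_of_subset_of_nonneg hsub fun k _ _ => le_max_right _ _)
  have h2 : -(∑ k, max (-D k) 0) ≤ ∑ i ∈ FIdx, D i := by
    have h : ∑ i ∈ FIdx, max (-D i) 0 ≤ ∑ k, max (-D k) 0 :=
      Finset.sum_le_sum_of_subset_of_nonneg hsub fun k _ _ => le_max_right _ _
    have h' : -(∑ i ∈ FIdx, max (-D i) 0) ≤ ∑ i ∈ FIdx, D i := by
      rw [← Finset.sum_neg_distrib]
      exact Finset.sum_le_sum fun i _ => by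
        have := le_max_left (-D i) 0
        linarith
    linarith
  have h3 : ∑ i ∈ FIdx, E i ≤ ∑ k, max (D k) 0 := by
    rw [← hP]
    exact (Finset.sum_le_sum fun i _ => le_max_left (E i) 0).trans
      (Finset.sum_le_sum_of_subset_of_nonneg hsub fun k _ _ => le_max_right _ _)
  have h4 : -(∑ k, max (-D k) 0) ≤ ∑ i ∈ FIdx, E i := by
    rw [← hN]
    have h : ∑ i ∈ FIdx, max (-E i) 0 ≤ ∑ k, max (-E k) 0 :=
      Finset.sum_le_sum_of_subset_of_nonneg hsub fun k _ _ => le_max_right _ _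
    have h' : -(∑ i ∈ FIdx, max (-E i) 0) ≤ ∑ i ∈ FIdx, E i := by
      rw [← Finset.sum_neg_distrib]
      exact Finset.sum_le_sum fun i _ => by
        have := le_max_left (-E i) 0
        linarith
    linarith
  rw [hdiff, ← habs, abs_le]
  constructor <;> linarith

/-- **Desk-note fact (a): one wall crossing moves `𝒩` by at most `1`.** For all `θ, θ′ ∈ ℝ⁸`,
`|𝒩(θ′) − 𝒩(θ)| ≤ Σ_k |⌊φ_k θ′⌋ − ⌊φ_k θ⌋|` = the number of integers (walls) separating `φ_k θ` from `φ_k θ′`,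
summed over the 28 forms. -/
theorem abs_torusN_sub_le_sum_abs_floor_sub (θ θ' : Fin 8 → ℝ) :
    |(torusN θ' : ℝ) - torusN θ| ≤ ∑ k : Fin 28, |(⌊phiForm θ' k⌋ : ℝ) - ⌊phiForm θ k⌋| := by
  rw [abs_sub_le_iff]
  constructor
  · obtain ⟨σ, -, hσ⟩ := Finset.exists_mem_eq_sup' Finset.univ_nonempty (torusTerm θ')
    have h1 : (torusN θ' : ℝ) = torusTerm θ' σ := by unfold torusN; rw [hσ]
    have h2 : (torusTerm θ σ : ℝ) ≤ torusN θ := by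
      exact_mod_cast Finset.le_sup' (torusTerm θ) (Finset.mem_univ σ)
    have h3 := (abs_sub_le_iff.mp (abs_torusTerm_sub_le θ θ' σ)).1
    linarith
  · obtain ⟨σ, -, hσ⟩ := Finset.exists_mem_eq_sup' Finset.univ_nonempty (torusTerm θ)
    have h1 : (torusN θ : ℝ) = torusTerm θ σ := by unfold torusN; rw [hσ]
    have h2 : (torusTerm θ' σ : ℝ) ≤ torusN θ' := by
      exact_mod_cast Finset.le_sup' (torusTerm θ') (Finset.mem_univ σ)
    have h3 := (abs_sub_le_iff.mp (abs_torusTerm_sub_le θ θ' σ)).2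
    linarith

/-- **Fact (a) along a displaced line**: `|𝒩(s·s(a) + c + Δ) − 𝒩(s·s(a) + c)| ≤
Σ_k |⌊s·h_k(a) + φ_k(c) + φ_k(Δ)⌋ − ⌊s·h_k(a) + φ_k(c)⌋|`. -/
theorem abs_torusN_line_sub_le (a : Dir) (c Δ : Fin 8 → ℝ) (s : ℝ) :
    |(torusN (s • sParam a + c + Δ) : ℝ) - torusN (s • sParam a + c)|
      ≤ ∑ k : Fin 28, |(⌊s * h28 a k + phiForm c k + phiForm Δ k⌋ : ℝ) - ⌊s * h28 a k + phiForm c k⌋| := by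
  have h := abs_torusN_sub_le_sum_abs_floor_sub (s • sParam a + c) (s • sParam a + c + Δ)
  simp_rw [phiForm_line_add, phiForm_line] at h
  exact h

/-! ### Monotone floor counts -/

/-- **Monotonicity of the crossing count in the displacement**: for `0 ≤ l ≤ t` and any `φ`,
`|⌊y + l·φ⌋ − ⌊y⌋| ≤ |⌊y + t·φ⌋ − ⌊y⌋|` (the walls crossed by the smaller displacement of the same sign are among
those crossed by the larger one). -/
theorem abs_floor_add_mul_sub_floor_le {l t : ℝ} (hl : 0 ≤ l) (hlt : l ≤ t) (y φ : ℝ) :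
    |(⌊y + l * φ⌋ : ℝ) - ⌊y⌋| ≤ |(⌊y + t * φ⌋ : ℝ) - ⌊y⌋| := by
  rcases le_total 0 φ with hφ | hφ
  · have h1 : ⌊y⌋ ≤ ⌊y + l * φ⌋ := Int.floor_le_floor (by nlinarith)
    have h2 : ⌊y + l * φ⌋ ≤ ⌊y + t * φ⌋ := Int.floor_le_floor (by nlinarith)
    have h1' : (⌊y⌋ : ℝ) ≤ ⌊y + l * φ⌋ := by exact_mod_cast h1
    have h2' : (⌊y + l * φ⌋ : ℝ) ≤ ⌊y + t * φ⌋ := by exact_mod_cast h2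
    rw [abs_of_nonneg (by linarith), abs_of_nonneg (by linarith)]
    linarith
  · have h1 : ⌊y + l * φ⌋ ≤ ⌊y⌋ := Int.floor_le_floor (by nlinarith)
    have h2 : ⌊y + t * φ⌋ ≤ ⌊y + l * φ⌋ := Int.floor_le_floor (by nlinarith)
    have h1' : (⌊y + l * φ⌋ : ℝ) ≤ ⌊y⌋ := by exact_mod_cast h1
    have h2' : (⌊y + t * φ⌋ : ℝ) ≤ ⌊y + l * φ⌋ := by exact_mod_cast h2
    rw [abs_of_nonpos (by linarith), abs_of_nonpos (by linarith)]
    linarith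

/-! ### Fact (b): exact equidistribution of `s·x (mod 1)` over a period -/

/-- `y ↦ ⌊y⌋` is interval integrable (monotone). -/
theorem intervalIntegrable_floor (α β : ℝ) : IntervalIntegrable (fun y : ℝ => (⌊y⌋ : ℝ)) volume α β :=
  Monotone.intervalIntegrable fun _ _ h => by exact_mod_cast Int.floor_le_floor h

/-- `s ↦ ⌊s·x + c⌋` is interval integrable for `x ≥ 0` (monotone). -/
theorem intervalIntegrable_floor_line {x : ℝ} (hx : 0 ≤ x) (c α β : ℝ) :
    IntervalIntegrable (fun s : ℝ => (⌊s * x + c⌋ : ℝ)) volume α β :=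
  Monotone.intervalIntegrable fun _ _ h => by
    exact_mod_cast Int.floor_le_floor (by nlinarith)

/-- Substitution: `∫₀ᵀ ⌊s·x + c⌋ ds = x⁻¹·∫_c^{N + c} ⌊y⌋ dy` when `T·x = N`. -/
theorem integral_floor_line_eq {x T c : ℝ} (hx : 0 < x) {N : ℤ} (hN : T * x = N) :
    ∫ s in (0 : ℝ)..T, (⌊s * x + c⌋ : ℝ) = x⁻¹ * ∫ y in c..((N : ℝ) + c), (⌊y⌋ : ℝ) := by
  have h := intervalIntegral.integral_comp_mul_add (a := 0) (b := T) (fun y : ℝ => (⌊y⌋ : ℝ)) hx.ne' c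
  simp only [mul_zero, zero_add, smul_eq_mul] at h
  rw [show x * T + c = (N : ℝ) + c by rw [mul_comm, hN]] at h
  rw [← h]
  refine intervalIntegral.integral_congr fun s _ => ?_
  simp only [mul_comm s x]

/-- **Desk-note fact (b): EXACT equidistribution over a period.** For `x > 0` with `T·x ∈ ℤ` and every `c, η`:
`∫₀ᵀ (⌊s·x + c + η⌋ − ⌊s·x + c⌋) ds = T·η` (as `s` runs over a period, `s·x` is exactly uniformly distributed
`mod 1`: the measure of `{s ∈ [0,T] : s·x + c ∈ (z − η, z] for some z ∈ ℤ}` is `T·η` for `0 ≤ η ≤ 1`, and the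
signed count is additive in general). -/
theorem integral_floor_shift_period {x T : ℝ} (hx : 0 < x) (hper : ∃ N : ℤ, T * x = N) (c η : ℝ) :
    ∫ s in (0 : ℝ)..T, ((⌊s * x + c + η⌋ : ℝ) - ⌊s * x + c⌋) = T * η := by
  obtain ⟨N, hN⟩ := hper
  have hfl := intervalIntegrable_floor
  rw [intervalIntegral.integral_sub ((intervalIntegrable_floor_line hx.le (c + η) 0 T).congr
      (fun s _ => by simp only [add_assoc])) (intervalIntegrable_floor_line hx.le c 0 T)]
  have e1 : ∫ s in (0 : ℝ)..T, (⌊s * x + c + η⌋ : ℝ) = x⁻¹ * ∫ y in (c + η)..((N : ℝ) + (c + η)), (⌊y⌋ : ℝ) := by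
    rw [← integral_floor_line_eq hx hN]
    refine intervalIntegral.integral_congr fun s _ => ?_
    simp only [add_assoc]
  rw [e1, integral_floor_line_eq hx hN, ← mul_sub,
    intervalIntegral.integral_interval_sub_interval_comm' (hfl _ _) (hfl _ _) (hfl _ _)]
  -- `∫_{N+c}^{N+c+η} ⌊y⌋ = ∫_c^{c+η} ⌊y + N⌋ = ∫_c^{c+η} ⌊y⌋ + N·η`
  have e2 : ∫ y in ((N : ℝ) + c)..((N : ℝ) + (c + η)), (⌊y⌋ : ℝ) = (∫ y in c..(c + η), (⌊y⌋ : ℝ)) + N * η := by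
    have h := intervalIntegral.integral_comp_add_right (a := c) (b := c + η) (fun y : ℝ => (⌊y⌋ : ℝ)) (N : ℝ)
    rw [show c + (N : ℝ) = (N : ℝ) + c by ring, show c + η + (N : ℝ) = (N : ℝ) + (c + η) by ring] at h
    rw [← h]
    have hN' : ∀ y : ℝ, (⌊y + (N : ℝ)⌋ : ℝ) = (⌊y⌋ : ℝ) + N := by
      intro y; rw [Int.floor_add_intCast]; push_cast; ring
    simp_rw [hN']
    rw [intervalIntegral.integral_add (hfl _ _) intervalIntegrable_const, intervalIntegral.integral_const,
      smul_eq_mul]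
    ring
  rw [e2]
  have hxT : x⁻¹ * ((N : ℝ) * η) = T * η := by
    rw [← hN]; field_simp
  rw [← hxT]
  ring

/-- **Fact (b), absolute form on `(0, T]`**: `∫_{(0,T]} |⌊s·x + c + η⌋ − ⌊s·x + c⌋| ds = T·|η|`. -/
theorem integral_abs_floor_shift_period {x T : ℝ} (hx : 0 < x) (hT : 0 ≤ T) (hper : ∃ N : ℤ, T * x = N)
    (c η : ℝ) : ∫ s in Ioc 0 T, |(⌊s * x + c + η⌋ : ℝ) - ⌊s * x + c⌋| = T * |η| := by
  rw [← intervalIntegral.integral_of_le hT]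
  rcases le_total 0 η with hη | hη
  · rw [abs_of_nonneg hη, ← integral_floor_shift_period hx hper c η]
    refine intervalIntegral.integral_congr fun s _ => abs_of_nonneg ?_
    have : ⌊s * x + c⌋ ≤ ⌊s * x + c + η⌋ := Int.floor_le_floor (by linarith)
    have : (⌊s * x + c⌋ : ℝ) ≤ ⌊s * x + c + η⌋ := by exact_mod_cast this
    linarith
  · rw [abs_of_nonpos hη, show T * -η = T * (-η) from rfl,
      ← integral_floor_shift_period hx hper (c + η) (-η)]
    refine intervalIntegral.integral_congr fun s _ => ?_
    have : ⌊s * x + c + η⌋ ≤ ⌊s * x + c⌋ := Int.floor_le_floor (by linarith)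
    have : (⌊s * x + c + η⌋ : ℝ) ≤ ⌊s * x + c⌋ := by exact_mod_cast this
    simp only [show s * x + (c + η) = s * x + c + η by ring]
    rw [abs_of_nonpos (by linarith)]
    ring

/-! ### The first-moment bound over a period, at the desk note's scale -/

/-- `s ↦ |⌊s·x + c + η⌋ − ⌊s·x + c⌋|` is integrable on `(0, T]`. -/
theorem integrableOn_abs_floor_shift {x : ℝ} (hx : 0 ≤ x) (c η : ℝ) {T : ℝ} (hT : 0 ≤ T) :
    IntegrableOn (fun s : ℝ => |(⌊s * x + c + η⌋ : ℝ) - ⌊s * x + c⌋|) (Ioc 0 T) := by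
  rw [← intervalIntegrable_iff_integrableOn_Ioc_of_le hT]
  exact (((intervalIntegrable_floor_line hx (c + η) 0 T).congr fun s _ => by simp only [add_assoc]).sub
    (intervalIntegrable_floor_line hx c 0 T)).abs

/-- **First-moment bound over a PERIOD, desk-note scale.** For a direction with all forms positive, a period `T`
(`T·h_k(a) ∈ ℤ`), an offset `c`, a displacement direction `δ` and a scalar profile `λ` with `0 ≤ λ(s) ≤ t` on
`(0, T]`: `∫_{(0,T]} |𝒩(s·s(a) + c + λ(s)·δ) − 𝒩(s·s(a) + c)| ds ≤ t·T·Σ_k |φ_k(δ)|`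
(fact (a) form by form, the count is monotone in the displacement, and fact (b) integrates it exactly). -/
theorem setIntegral_abs_torusN_sub_le_period {a : Dir} (hpos : ∀ k, 0 < h28 a k) {T : ℝ} (hT : 0 ≤ T)
    (hper : ∀ k : Fin 28, ∃ z : ℤ, T * h28 a k = z) (c δ : Fin 8 → ℝ) (lam : ℝ → ℝ) {t : ℝ}
    (hlam : ∀ s ∈ Ioc 0 T, 0 ≤ lam s ∧ lam s ≤ t) :
    ∫ s in Ioc 0 T, |(torusN (s • sParam a + c + lam s • δ) : ℝ) - torusN (s • sParam a + c)|
      ≤ t * T * ∑ k, |phiForm δ k| := by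
  -- the dominating function: form by form, the count of the MAXIMAL displacement `t·δ`
  set G : ℝ → ℝ := fun s => ∑ k : Fin 28,
    |(⌊s * h28 a k + phiForm c k + t * phiForm δ k⌋ : ℝ) - ⌊s * h28 a k + phiForm c k⌋| with hG
  have hGint : Integrable G (volume.restrict (Ioc 0 T)) := by
    refine integrable_finsetSum _ fun k _ => ?_
    exact integrableOn_abs_floor_shift (hpos k).le (phiForm c k) (t * phiForm δ k) hT
  have hGval : ∫ s in Ioc 0 T, G s = t * T * ∑ k, |phiForm δ k| := by
    rw [integral_finsetSum _ fun k _ => integrableOn_abs_floor_shift (hpos k).le (phiForm c k) _ hT,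
      Finset.mul_sum]
    refine Finset.sum_congr rfl fun k _ => ?_
    rw [integral_abs_floor_shift_period (hpos k) hT (hper k), abs_mul]
    rcases (Ioc 0 T).eq_empty_or_nonempty with h0 | ⟨s, hs⟩
    · have : T = 0 := le_antisymm (by simpa [Set.Ioc_eq_empty_iff, not_lt] using h0) hT
      simp [this]
    · rw [abs_of_nonneg ((hlam s hs).1.trans (hlam s hs).2)]; ring
  have hdom : ∀ s ∈ Ioc 0 T,
      |(torusN (s • sParam a + c + lam s • δ) : ℝ) - torusN (s • sParam a + c)| ≤ G s := by
    intro s hs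
    refine (abs_torusN_line_sub_le a c (lam s • δ) s).trans (Finset.sum_le_sum fun k _ => ?_)
    rw [phiForm_smul]
    exact abs_floor_add_mul_sub_floor_le (hlam s hs).1 (hlam s hs).2 _ _
  calc ∫ s in Ioc 0 T, |(torusN (s • sParam a + c + lam s • δ) : ℝ) - torusN (s • sParam a + c)|
      ≤ ∫ s in Ioc 0 T, G s := by
        refine integral_mono_of_nonneg (Filter.Eventually.of_forall fun s => abs_nonneg _) hGint ?_
        exact (ae_restrict_iff' measurableSet_Ioc).mpr (Filter.Eventually.of_forall hdom)
    _ = t * T * ∑ k, |phiForm δ k| := hGval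

/-- **Drift over one period** (`λ(s) = s·ε`): `∫_{(0,T]} |𝒩(s·s(a) + c + (sε)·δ) − 𝒩(s·s(a) + c)| ≤ εT·T·Σ|φ_k δ|`. -/
theorem setIntegral_abs_torusN_drift_le_period {a : Dir} (hpos : ∀ k, 0 < h28 a k) {T : ℝ} (hT : 0 ≤ T)
    (hper : ∀ k : Fin 28, ∃ z : ℤ, T * h28 a k = z) (c δ : Fin 8 → ℝ) {ε : ℝ} (hε : 0 ≤ ε) :
    ∫ s in Ioc 0 T, |(torusN (s • sParam a + c + (s * ε) • δ) : ℝ) - torusN (s • sParam a + c)|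
      ≤ (ε * T) * T * ∑ k, |phiForm δ k| :=
  setIntegral_abs_torusN_sub_le_period hpos hT hper c δ (fun s => s * ε) fun s hs =>
    ⟨mul_nonneg hs.1.le hε, by nlinarith [hs.2]⟩

/-- **Rigid translate over one period** (`λ ≡ η ≥ 0`, offset `0`):
`∫_{(0,T]} |𝒩(s·s(a) + η·δ) − 𝒩(s·s(a))| ≤ η·T·Σ|φ_k δ|`. -/
theorem setIntegral_abs_torusN_translate_le_period {a : Dir} (hpos : ∀ k, 0 < h28 a k) {T : ℝ} (hT : 0 ≤ T)
    (hper : ∀ k : Fin 28, ∃ z : ℤ, T * h28 a k = z) (δ : Fin 8 → ℝ) {η : ℝ} (hη : 0 ≤ η) :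
    ∫ s in Ioc 0 T, |(torusN (s • sParam a + η • δ) : ℝ) - torusN (s • sParam a)| ≤ η * T * ∑ k, |phiForm δ k| := by
  have h := setIntegral_abs_torusN_sub_le_period hpos hT hper 0 δ (fun _ => η) (t := η)
    fun s _ => ⟨hη, le_rfl⟩
  simpa only [add_zero] using h

end Summit.KontsevichZagierPeriods.Zeta5Search.Barrier.ConeGamma

end
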